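import Summits.NavierStokesRegularity.FluidComputer.LocalisationFace
import Literature.Analysis.FluidPDE.ESSLocalHolderTopCylinder
import Literature.Analysis.FluidPDE.NSSuitableESSProofs
import Literature.Analysis.FluidPDE.ClassicalSuitable
import HarnessLib

/-!
# Fluid computer — the level dictionary, LOCAL CRITICAL DIVERGENCE (L36): at the focus the `L³` mass of EVERY
# ball is unbounded as `t ↑ T` (Escauriaza–Seregin–Šverák, local form)

HONEST FRAMING (cell `pub-fluidc`, verbatim): *low prior, high value-of-information experiment on Tao's
machine paradigm; NOT a claim that NS blows up.* Theorem side of the cell; nothing here is evidence of blow-up.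
L27 says `‖u(t)‖_{L³(ℝ³)} → ∞`; L33″ puts the divergence inside a fixed ball; L34 gives an `ε` of space–time mass
at every scale around the focus. The LOCAL theorem of Escauriaza–Seregin–Šverák (Russ. Math. Surveys 58 (2003),
Thm. 1.4 — PROVED in the tree: `ess_local_holder_holds`, and put at the top of a backward cylinder of any size and
viscosity in `ess_bounded_near_top_of_L3`) sharpens all three at the focus: if `u` were bounded in
`L^∞(T − r², T; L³(B_r(x₀)))` for ONE radius `r`, the point `(T, x₀)` would be regular. For every maximal smooth
solution `(u, p)` of the unforced Navier–Stokes system on `ℝ³ × [0, T)` (`ν > 0`) which is Leray–Hopf from `u 0`: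

* `exists_isLRSuitableWeakSolutionOn_cylinder_top` — `(u, p̃)` (Riesz-normalised pressure gauge) lies in
  Lemarié-Rieusset's §14.3 suitable class on EVERY backward cylinder `Q_r(T, x₀)` whose top is the lifespan
  (`0 < r`, `r² ≤ T`): the energy class from Leray's inequality, the dissipation THROUGH `T`
  (`BandFluxCeiling.dissipation_le_energy`, with the a.e. identification of the weak gradient with the classical
  one), the gauged pressure in `L^{3/2}` of the slab (`SereginSverak2002.lintegral_slab_gauged_pressure_lt_top`),
  the equations and the local energy inequality restricted from the slab
  (`SereginSverak2002.isSuitableWeakSolutionOn_gauge_of_classical`).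
* `not_ae_local_L3_le_of_singular` (**L36 — LOCAL ESS AT A SINGULAR POINT**): if `x₀` is a point at which `u` is
  unbounded on every backward parabolic neighbourhood, then for EVERY `0 < r`, `r² ≤ T` and every `C` it is NOT the
  case that `∫_{B_r(x₀)} |u(t)|³ ≤ C` for a.e. `t ∈ (T − r², T)`.
* `local_L3_unbounded_at_focus` (**L36, assembled with L33′**): there is a focus `x₀` such that for every radius
  `r > 0`, every `t₀ < T` and every `C` some `t ∈ (t₀, T)` has `∫_{B_r(x₀)} |u(t)|³ > C` —
  `limsup_{t↑T} ‖u(t)‖_{L³(B_r(x₀))} = ∞` FOR EVERY `r`: the critical mass of every ball around the focus is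
  unbounded.

Reading: however small the ball around its focus, a blow-up must pump unbounded critical mass into it (in
`limsup`); contrast L34 (an `ε` at every scale, for all late times in the cylinder average) and L27 (the global
norm has a genuine limit `∞`). Scale-free; no constant at all. Necessity only. 0 sorry; no new definitions, no named
facts.

## References

* L. Escauriaza, G. Seregin, V. Šverák, Russ. Math. Surveys 58:2 (2003) 211–250, Thm. 1.4, §3.
  [EscauriazaSereginSverak2003]
* G. Seregin, *Lecture Notes on Regularity Theory for the Navier–Stokes Equations*, World Scientific 2014, Ch. 6.
  [Seregin2014]
* P. G. Lemarié-Rieusset, *The Navier–Stokes Problem in the 21st Century*, CRC 2016, §14.3. [LemarieRieusset2016]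
-/

noncomputable section

open MeasureTheory Set Function Filter Topology TopologicalSpace Metric
open scoped ENNReal NNReal RealInnerProductSpace
open Literature.Analysis.FluidPDE Literature.Analysis.FunctionSpaces
open Summit.NavierStokesRegularity.FluidComputer.LocalisationFace

namespace Summit.NavierStokesRegularity.FluidComputer.LocalCriticalDivergence

/-! ## The §14.3 class on backward cylinders whose top is the lifespan -/

/-- **Lemarié-Rieusset's standing hypotheses (§14.3) on every backward cylinder `Q_r(T, x₀)` whose top is the
lifespan**, for a maximal smooth Leray–Hopf solution of the unforced system (`ν > 0`) and its Riesz-normalised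
pressure gauge `p̃(t, x) = p(t, x) − (p(t, 0) − ϖ[u(t)](0))`, `0 < r`, `r² ≤ T`: connected domain, `u ∈ L^∞_t L²_x`
(Leray's energy inequality), a weak gradient square integrable THROUGH `T` (the a.e. identification
`HasWeakSpatialGradientOn.ae_eq` with the classical gradient and `BandFluxCeiling.dissipation_le_energy`),
`p̃ ∈ L^{3/2}` of the slab, force `0`, the equations and the local energy inequality restricted from the open slab
(`SereginSverak2002.isSuitableWeakSolutionOn_gauge_of_classical`).
[cite: LemarieRieusset2016, §14.3 hypotheses of Thm. 14.4 (p. 505)] -/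
theorem exists_isLRSuitableWeakSolutionOn_cylinder_top {ν T : ℝ} (hν : 0 < ν) (hT : 0 < T)
    {u : ℝ → EuclideanSpace ℝ (Fin 3) → EuclideanSpace ℝ (Fin 3)} {p : ℝ → EuclideanSpace ℝ (Fin 3) → ℝ}
    (hmax : IsMaximalSmoothSolution ν 0 u p T) (hLH : IsLerayHopfOn T ν 0 (u 0) u)
    (x₀ : EuclideanSpace ℝ (Fin 3)) {r : ℝ} (hr : 0 < r) (hrT : r ^ 2 ≤ T) :
    ∃ G : ℝ → EuclideanSpace ℝ (Fin 3) → EuclideanSpace ℝ (Fin 3) →L[ℝ] EuclideanSpace ℝ (Fin 3),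
      IsLRSuitableWeakSolutionOn (parabolicCylinderOpens r ((T : ℝ), x₀)) ν 3 0 u
        (fun t x => p t x - (p t 0 - normalisedPressure (u t) 0)) G := by
  set qg : ℝ → EuclideanSpace ℝ (Fin 3) → ℝ := fun t x => p t x - (p t 0 - normalisedPressure (u t) 0)
    with hqg
  set Q : Opens (ℝ × EuclideanSpace ℝ (Fin 3)) :=
    ⟨Ioo 0 T ×ˢ univ, isOpen_Ioo.prod isOpen_univ⟩ with hQdef
  have hQ : (Q : Set (ℝ × EuclideanSpace ℝ (Fin 3))) ⊆ Ioo 0 T ×ˢ univ := Subset.rfl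
  have hsw : IsSuitableWeakSolutionOn Q ν 0 u qg :=
    SereginSverak2002.isSuitableWeakSolutionOn_gauge_of_classical hν hT hmax.1 hLH Q hQ
  obtain ⟨G, hG, -, hloc⟩ := hsw.localEnergy
  set Ω : Opens (ℝ × EuclideanSpace ℝ (Fin 3)) := parabolicCylinderOpens r ((T : ℝ), x₀) with hΩdef
  have hΩ : (Ω : Set (ℝ × EuclideanSpace ℝ (Fin 3))) = parabolicCylinder r ((T : ℝ), x₀) := rfl
  have hΩsub : (Ω : Set (ℝ × EuclideanSpace ℝ (Fin 3))) ⊆ Ioo 0 T ×ˢ (univ : Set (EuclideanSpace ℝ (Fin 3))) := by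
    intro z hz
    have hz' : z ∈ parabolicCylinder r ((T : ℝ), x₀) := hz
    rw [mem_parabolicCylinder] at hz'
    exact ⟨⟨by nlinarith [hz'.1.1], hz'.1.2⟩, mem_univ _⟩
  have hΩle : Ω ≤ Q := fun z hz => hΩsub hz
  -- the classical gradient is a weak gradient on the slab; identify it with `G` a.e.
  have hfd : HasWeakSpatialGradientOn Q u fun t x => fderiv ℝ (u t) x :=
    hasWeakSpatialGradientOn_of_contDiffOn isOpen_Ioo hQ
      ((hmax.1.mono Ioo_subset_Ico_self isOpen_Ioo.uniqueDiffOn).smooth_velocity.of_le (by norm_cast))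
  have hae := hG.ae_eq hfd
  -- energy, dissipation through `T`, gauged pressure on the slab
  have hu0 : MemLp (u 0) 2 volume := hLH.memLp 0 ⟨le_rfl, hT.le⟩
  have hdis := (BandFluxCeiling.dissipation_le_energy hν hT hmax hLH).1
  have hpress := SereginSverak2002.lintegral_slab_gauged_pressure_lt_top hν hT hmax.1 hLH
  refine ⟨G,
    { isConnected := ?_
      energyClass := ?_
      weakGradient := hG.mono hΩle
      gradient_lt_top := ?_
      pressure_lt_top := (lintegral_mono_set hΩsub).trans_lt hpress
      force_memLp := ?_
      distributional := (hsw.of_le hΩle).distributional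
      localEnergy := fun φ hφ hφ0 => hloc φ (hφ.mono hΩle) hφ0 }⟩
  · -- a cylinder is connected
    rw [hΩ, parabolicCylinder]
    refine ⟨⟨(T - r ^ 2 / 2, x₀), ?_⟩, ((convex_Ioo _ _).prod (convex_ball _ _)).isPreconnected⟩
    exact ⟨⟨by nlinarith, by nlinarith⟩, mem_ball_self hr⟩
  · -- `u ∈ L^∞_t L²_x(Ω)`: one bound from Leray's energy inequality
    refine ⟨((eLpNorm (u 0) 2 volume) ^ 2).toNNReal, ae_of_all _ fun t => ?_⟩
    rw [ENNReal.coe_toNNReal (ENNReal.pow_ne_top hu0.eLpNorm_ne_top)]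
    by_cases ht : t ∈ Icc 0 T
    · have h2 := eLpNorm_natCast_pow_eq_lintegral volume (u t) (n := 2) (by norm_num)
      simp only [Nat.cast_ofNat] at h2
      calc ∫⁻ x, (Ω : Set (ℝ × EuclideanSpace ℝ (Fin 3))).indicator
            (fun z : ℝ × EuclideanSpace ℝ (Fin 3) => ‖u z.1 z.2‖ₑ ^ 2) (t, x)
          ≤ ∫⁻ x, ‖u t x‖ₑ ^ 2 := lintegral_mono fun x => indicator_le_self _ _ _
        _ = eLpNorm (u t) 2 volume ^ 2 := h2.symm
        _ ≤ eLpNorm (u 0) 2 volume ^ 2 := pow_le_pow_left' (hLH.eLpNorm_le_eLpNorm_datum hν.le hu0 ht) 2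
    · have h0 : ∀ x, (Ω : Set (ℝ × EuclideanSpace ℝ (Fin 3))).indicator
          (fun z : ℝ × EuclideanSpace ℝ (Fin 3) => ‖u z.1 z.2‖ₑ ^ 2) (t, x) = 0 := by
        intro x
        rw [indicator_of_notMem]
        intro hz
        exact ht ⟨(hΩsub hz).1.1.le, (hΩsub hz).1.2.le⟩
      simp only [h0, lintegral_zero, zero_le]
  · -- `∇u ∈ L²(Ω)` through `T`
    have e : ∫⁻ w in (Ω : Set (ℝ × EuclideanSpace ℝ (Fin 3))),
        ENNReal.ofReal (frobeniusNormSq (G w.1 w.2)) =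
          ∫⁻ w in (Ω : Set (ℝ × EuclideanSpace ℝ (Fin 3))),
            ENNReal.ofReal (frobeniusNormSq (fderiv ℝ (u w.1) w.2)) := by
      refine lintegral_congr_ae ?_
      have hae' := ae_restrict_of_ae_restrict_of_subset (μ := volume) hΩle hae
      filter_upwards [hae'] with w hw
      change ENNReal.ofReal (frobeniusNormSq (uncurry G w)) =
        ENNReal.ofReal (frobeniusNormSq (uncurry (fun t x => fderiv ℝ (u t) x) w))
      rw [hw]
    rw [e]
    exact ((lintegral_mono_set hΩsub).trans
      (SereginSverak2002.lintegral_slab_le_lintegral_lintegral _ _)).trans_lt hdis.lt_top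
  · -- the zero force
    have h0 : uncurry (0 : ℝ → EuclideanSpace ℝ (Fin 3) → EuclideanSpace ℝ (Fin 3)) = 0 := rfl
    rw [h0]
    exact MemLp.zero

/-! ## L36: local ESS at a singular point -/

/-- **L36 — LOCAL ESCAURIAZA–SEREGIN–ŠVERÁK AT A SINGULAR POINT.** Let `(u, p)` be a maximal smooth solution of
the unforced Navier–Stokes system on `ℝ³ × [0, T)` (`ν > 0`), Leray–Hopf from `u 0`, and let `x₀` be a point at
which `u` is unbounded on every backward parabolic neighbourhood `(T − r², T) × B_r(x₀)`. Then for every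
`0 < r`, `r² ≤ T` and every `C` it is NOT the case that `∫_{B_r(x₀)} |u(t)|³ ≤ C` for a.e. `t ∈ (T − r², T)`:
otherwise `ess_bounded_near_top_of_L3` (ESS Thm. 1.4 at the top of the cylinder, PROVED in the tree) bounds `u`
essentially on a backward cylinder at `(T, x₀)`, hence pointwise below `T` by continuity, contradicting the
singularity. [cite: EscauriazaSereginSverak2003, Thm. 1.4 and §3] [cite: Seregin2014, Ch. 6] -/
theorem not_ae_local_L3_le_of_singular {ν T : ℝ} (hν : 0 < ν) (hT : 0 < T)
    {u : ℝ → EuclideanSpace ℝ (Fin 3) → EuclideanSpace ℝ (Fin 3)} {p : ℝ → EuclideanSpace ℝ (Fin 3) → ℝ}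
    (hmax : IsMaximalSmoothSolution ν 0 u p T) (hLH : IsLerayHopfOn T ν 0 (u 0) u)
    {x₀ : EuclideanSpace ℝ (Fin 3)}
    (hsing : ∀ r : ℝ, 0 < r → ∀ M : ℝ, ∃ t ∈ Ioo (T - r ^ 2) T, 0 < t ∧ ∃ x ∈ ball x₀ r, M < ‖u t x‖)
    {r : ℝ} (hr : 0 < r) (hrT : r ^ 2 ≤ T) (C : ℝ≥0) :
    ¬ (∀ᵐ t ∂(volume.restrict (Ioo (T - r ^ 2) T)), ∫⁻ x in ball x₀ r, ‖u t x‖ₑ ^ 3 ≤ C) := by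
  intro hL3
  obtain ⟨G, hLR⟩ := exists_isLRSuitableWeakSolutionOn_cylinder_top hν hT hmax hLH x₀ hr hrT
  obtain ⟨r₁, hr₁, hbd⟩ := ess_bounded_near_top_of_L3 hν hLR ⟨C, hL3⟩ ((T : ℝ), x₀)
    ⟨by simp only; nlinarith, le_rfl⟩ (mem_ball_self hr)
  -- the essential bound on `Q_{r₁}(T, x₀)` is a pointwise bound on its part below `T` and above `0`
  set W : Set (ℝ × EuclideanSpace ℝ (Fin 3)) := parabolicCylinder r₁ ((T : ℝ), x₀) with hW
  set V : Set (ℝ × EuclideanSpace ℝ (Fin 3)) := W ∩ (Ioi (0 : ℝ) ×ˢ (univ : Set (EuclideanSpace ℝ (Fin 3))))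
    with hV
  set N : ℝ := (eLpNorm (uncurry u) ⊤ (volume.restrict W)).toReal with hN
  have hNtop : eLpNorm (uncurry u) ⊤ (volume.restrict W) ≠ ⊤ := hbd.ne
  have haeW : ∀ᵐ z ∂(volume.restrict W), ‖uncurry u z‖ ≤ N := by
    filter_upwards [ae_le_eLpNormEssSup (f := uncurry u) (μ := volume.restrict W)] with z hz
    rw [← eLpNorm_exponent_top] at hz
    rw [← ofReal_norm] at hz
    exact (ENNReal.ofReal_le_iff_le_toReal hNtop).1 hz
  have haeV : ∀ᵐ z ∂(volume.restrict V), ‖uncurry u z‖ ≤ N :=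
    ae_restrict_of_ae_restrict_of_subset inter_subset_left haeW
  have hVo : IsOpen V := (isOpen_parabolicCylinder _ _).inter (isOpen_Ioi.prod isOpen_univ)
  have hVsub : V ⊆ Ico 0 T ×ˢ (univ : Set (EuclideanSpace ℝ (Fin 3))) := by
    rintro z ⟨hzW, hzt, -⟩
    rw [hW, mem_parabolicCylinder] at hzW
    exact ⟨⟨(mem_Ioi.1 hzt).le, hzW.1.2⟩, mem_univ _⟩
  have hcont : ContinuousOn (uncurry u) V := (SereginSverak2002.continuousOn_uncurry hmax.1).mono hVsub
  have hpt : ∀ z ∈ V, ‖uncurry u z‖ ≤ N :=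
    SereginSverak2002.norm_le_of_ae_restrict_of_continuousOn hVo hcont haeV
  -- the singular point beats the bound
  obtain ⟨t, ht, ht0, x, hx, hbig⟩ := hsing r₁ hr₁ N
  have hmem : ((t, x) : ℝ × EuclideanSpace ℝ (Fin 3)) ∈ V := by
    refine ⟨?_, mem_Ioi.2 ht0, mem_univ _⟩
    rw [hW, mem_parabolicCylinder]
    exact ⟨⟨ht.1, ht.2⟩, mem_ball.1 hx⟩
  have hle := hpt _ hmem
  simp only [uncurry] at hle
  linarith

/-- **L36, POINTWISE-IN-TIME FORM at a singular point**: for every radius `r > 0`, every `t₀ ∈ [0, T)` and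
every `C`, some `t ∈ (t₀, T)` has `C < ∫_{B_r(x₀)} |u(t)|³` (shrink the radius to `r' = min r √(T − t₀)` so that
`(T − r'², T) ⊆ (t₀, T)` and `B_{r'} ⊆ B_r`, and apply `not_ae_local_L3_le_of_singular`).
[cite: EscauriazaSereginSverak2003, Thm. 1.4 and §3] -/
theorem exists_local_L3_gt_of_singular {ν T : ℝ} (hν : 0 < ν) (hT : 0 < T)
    {u : ℝ → EuclideanSpace ℝ (Fin 3) → EuclideanSpace ℝ (Fin 3)} {p : ℝ → EuclideanSpace ℝ (Fin 3) → ℝ}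
    (hmax : IsMaximalSmoothSolution ν 0 u p T) (hLH : IsLerayHopfOn T ν 0 (u 0) u)
    {x₀ : EuclideanSpace ℝ (Fin 3)}
    (hsing : ∀ r : ℝ, 0 < r → ∀ M : ℝ, ∃ t ∈ Ioo (T - r ^ 2) T, 0 < t ∧ ∃ x ∈ ball x₀ r, M < ‖u t x‖)
    {r : ℝ} (hr : 0 < r) {t₀ : ℝ} (ht₀ : t₀ ∈ Ico 0 T) (C : ℝ≥0) :
    ∃ t ∈ Ioo t₀ T, (C : ℝ≥0∞) < ∫⁻ x in ball x₀ r, ‖u t x‖ₑ ^ 3 := by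
  -- the shrunk radius
  set r' : ℝ := min r (Real.sqrt (T - t₀)) with hr'
  have hTt₀ : 0 < T - t₀ := sub_pos.2 ht₀.2
  have hr'pos : 0 < r' := lt_min hr (Real.sqrt_pos.2 hTt₀)
  have hr'r : r' ≤ r := min_le_left _ _
  have hr'sq : r' ^ 2 ≤ T - t₀ := by
    have h1 : r' ≤ Real.sqrt (T - t₀) := min_le_right _ _
    calc r' ^ 2 ≤ (Real.sqrt (T - t₀)) ^ 2 := pow_le_pow_left₀ hr'pos.le h1 2
      _ = T - t₀ := Real.sq_sqrt hTt₀.le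
  have hr'T : r' ^ 2 ≤ T := hr'sq.trans (by linarith [ht₀.1])
  by_contra hno
  push Not at hno
  refine not_ae_local_L3_le_of_singular hν hT hmax hLH hsing hr'pos hr'T C ?_
  rw [ae_restrict_iff' measurableSet_Ioo]
  refine Eventually.of_forall fun t ht => ?_
  have htI : t ∈ Ioo t₀ T := ⟨by linarith [ht.1], ht.2⟩
  calc ∫⁻ x in ball x₀ r', ‖u t x‖ₑ ^ 3 ≤ ∫⁻ x in ball x₀ r, ‖u t x‖ₑ ^ 3 :=
        lintegral_mono_set (ball_subset_ball hr'r)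
    _ ≤ C := hno t htI

/-- **L36 — AT THE FOCUS THE CRITICAL MASS OF EVERY BALL IS UNBOUNDED.** For every `ν > 0`, `T > 0` and every
maximal smooth solution `(u, p)` of the unforced Navier–Stokes system on `ℝ³ × [0, T)` which is Leray–Hopf from
`u 0`, there is a point `x₀` (the singular point of `LocalisationFace.exists_singularPoint`) such that for every
radius `r > 0`, every `t₀ ∈ [0, T)` and every `C` some `t ∈ (t₀, T)` has `∫_{B_r(x₀)} |u(t)|³ > C` — i.e.
`limsup_{t↑T} ‖u(t)‖_{L³(B_r(x₀))} = ∞` for EVERY `r`. [cite: EscauriazaSereginSverak2003, Thm. 1.4 and §3]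
[cite: Seregin2014, Ch. 6] -/
theorem local_L3_unbounded_at_focus {ν T : ℝ} (hν : 0 < ν) (hT : 0 < T)
    {u : ℝ → EuclideanSpace ℝ (Fin 3) → EuclideanSpace ℝ (Fin 3)} {p : ℝ → EuclideanSpace ℝ (Fin 3) → ℝ}
    (hmax : IsMaximalSmoothSolution ν 0 u p T) (hLH : IsLerayHopfOn T ν 0 (u 0) u) :
    ∃ x₀ : EuclideanSpace ℝ (Fin 3),
      (∀ r : ℝ, 0 < r → ∀ M : ℝ, ∃ t ∈ Ioo (T - r ^ 2) T, 0 < t ∧ ∃ x ∈ ball x₀ r, M < ‖u t x‖) ∧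
      ∀ r : ℝ, 0 < r → ∀ t₀ ∈ Ico 0 T, ∀ C : ℝ≥0,
        ∃ t ∈ Ioo t₀ T, (C : ℝ≥0∞) < ∫⁻ x in ball x₀ r, ‖u t x‖ₑ ^ 3 := by
  obtain ⟨x₀, hsing⟩ := exists_singularPoint hν hT hmax hLH
  exact ⟨x₀, hsing, fun r hr t₀ ht₀ C => exists_local_L3_gt_of_singular hν hT hmax hLH hsing hr ht₀ C⟩

end Summit.NavierStokesRegularity.FluidComputer.LocalCriticalDivergence

end
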